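import Summits.ValiantsHypothesis.ValiantsHypothesis.Theorems.SymmetroidDescartesDerivedPencilRolleStairDefs

/-!
# Route SymmetroidDescartes — refutation of `DerivedPencilRolle` (stmt-ValiantsHypothesis-18500):
the staircase family — walks through a staircase, canonical walks, covariance

Structure of the finite-cost walks through one staircase `J_k(p)` (they are the `stair(e, r)`,
with the closed-form cost `stairCost`), lengths, the cost of the canonical walk (H1:
`walkCost_canon`) and the COVARIANCE of the value function in the entering row (`val_cov`).
-/

-- single-conjunct layout: Sub = Summit, duplicated namespace component intended
set_option linter.dupNamespace false

namespace Summit.ValiantsHypothesis.ValiantsHypothesis.Theorems.SymmetroidDescartes.DPR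

open scoped BigOperators

section
variable (n L : ℕ)

/-- `J_k(p)` has `n + 1` layers (for `n ≥ 1`). [folklore] -/
theorem length_stairJ (k : ℕ) (p : ℤ) (hn : 1 ≤ n) : (stairJ n L k p).length = n + 1 := by
  simp [stairJ]; omega

/-- The exponent of class `cl L k` is `P k` for `1 ≤ k ≤ L`. [folklore] -/
theorem expo_cl (k : ℕ) (hk : 1 ≤ k) (hkL : k ≤ L) : expo n L (cl L k) = slopeP n L k := by
  simp [expo, cl, Nat.min_eq_left hkL]; omega

/-- The exponent of the flat class is `0`. [folklore] -/
@[simp] theorem expo_flat : expo n L ⟨0, Nat.succ_pos L⟩ = 0 := by simp [expo]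

/-- Step cost of a flat edge: its weight. [folklore] -/
@[simp] theorem stepCost_flatE (lam a : ℤ) :
    stepCost (expo n L) lam (some (flatE L a)) = (a : WithTop ℤ) := by
  simp [stepCost, flatE, expo]

/-- From the base, the only finite-cost walk through climb layers stays at the base, at cost `0`.
[folklore] -/
theorem climbs_from_base (k : ℕ) (p lam : ℤ) :
    ∀ (m s ρ : ℕ) (w : List (ℕ × Bool)),
      walkCost (expo n L) lam (climbs n L k p s m) (ρ, false) w ≠ ⊤ →
        w = List.replicate m (ρ, false) ∧
          walkCost (expo n L) lam (climbs n L k p s m) (ρ, false) w = 0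
  | 0, s, ρ, [], _ => by simp
  | 0, s, ρ, _ :: _, h => by simp at h
  | m + 1, s, ρ, [], h => by simp at h
  | m + 1, s, ρ, v' :: w, h => by
      rw [climbs_succ, walkCost_cons_cons] at h ⊢
      have hstep : climbLayer n L k p s (ρ, false) v' = if v'.2 = false ∧ v'.1 = ρ then
          some (flatE L 0) else none := by
        simp [climbLayer]
      by_cases hv : v'.2 = false ∧ v'.1 = ρ
      · have hv' : v' = (ρ, false) := Prod.ext hv.2 hv.1
        subst hv'
        rw [hstep, if_pos hv, stepCost_flatE] at h ⊢
        have h' : walkCost (expo n L) lam (climbs n L k p (s + 1) m) (ρ, false) w ≠ ⊤ := by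
          intro htop; rw [htop] at h; exact h rfl
        obtain ⟨hw, hc⟩ := climbs_from_base k p lam m (s + 1) ρ w h'
        refine ⟨by rw [hw]; rfl, ?_⟩
        rw [hc]; rfl
      · rw [hstep, if_neg hv] at h
        exact absurd rfl h

/-- `climbWalk ρ m 0` stays at the base. [folklore] -/
theorem climbWalk_zero : ∀ (ρ m : ℕ), climbWalk ρ m 0 = List.replicate m (ρ, false)
  | _, 0 => rfl
  | ρ, m + 1 => by rw [climbWalk, climbWalk_zero ρ m]; rfl

/-- Staying at the base through climb layers costs `0`. [folklore] -/
theorem walkCost_replicate_base (k : ℕ) (p lam : ℤ) :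
    ∀ (m s ρ : ℕ), walkCost (expo n L) lam (climbs n L k p s m) (ρ, false)
      (List.replicate m (ρ, false)) = 0
  | 0, _, _ => rfl
  | m + 1, s, ρ => by
      rw [List.replicate_succ, climbs_succ, walkCost_cons_cons, walkCost_replicate_base k p lam m]
      simp [climbLayer]

/-- The climb layer seen from a climbing vertex. [folklore] -/
theorem climbLayer_true (k : ℕ) (p : ℤ) (s ρ : ℕ) (v' : ℕ × Bool) :
    climbLayer n L k p s (ρ, true) v' =
      if v'.2 = true ∧ v'.1 = ρ + 1 then
        some ⟨(slopeP n L k : ℤ) * (2 * hw n L k) * (s + 2) + p * ((ρ : ℤ) - s) * (2 * hw n L k),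
          cl L k, decide (k = L)⟩
      else if v'.2 = false ∧ v'.1 = ρ then some (flatE L 0) else none := by
  simp [climbLayer]

/-- From a climbing vertex, a finite-cost walk through `m` climb layers climbs some `r ≤ m` times
and then stays at the base; its cost is `climbCost`. [folklore] -/
theorem climbs_from_climb (k : ℕ) (hk : 1 ≤ k) (hkL : k ≤ L) (p lam : ℤ) :
    ∀ (m s ρ : ℕ) (w : List (ℕ × Bool)),
      walkCost (expo n L) lam (climbs n L k p s m) (ρ, true) w ≠ ⊤ →
        ∃ r, r ≤ m ∧ w = climbWalk ρ m r ∧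
          walkCost (expo n L) lam (climbs n L k p s m) (ρ, true) w = (climbCost n L k p s ρ r lam : ℤ)
  | 0, s, ρ, [], _ => ⟨0, le_rfl, rfl, by simp [climbCost]⟩
  | 0, s, ρ, _ :: _, h => by simp at h
  | m + 1, s, ρ, [], h => by simp at h
  | m + 1, s, ρ, v' :: w, h => by
      rw [climbs_succ, walkCost_cons_cons, climbLayer_true] at h ⊢
      by_cases hup : v'.2 = true ∧ v'.1 = ρ + 1
      · have hv' : v' = (ρ + 1, true) := Prod.ext hup.2 hup.1
        subst hv'
        rw [if_pos hup] at h ⊢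
        have h' : walkCost (expo n L) lam (climbs n L k p (s + 1) m) (ρ + 1, true) w ≠ ⊤ := by
          intro htop; rw [htop] at h; exact h (by simp)
        obtain ⟨r, hr, hw, hc⟩ := climbs_from_climb k hk hkL p lam m (s + 1) (ρ + 1) w h'
        refine ⟨r + 1, by omega, by rw [hw]; rfl, ?_⟩
        rw [hc, stepCost, expo_cl n L k hk hkL, ← WithTop.coe_add]
        congr 1
        simp only [climbCost]
        push_cast
        ring
      · rw [if_neg hup] at h ⊢
        by_cases hstop : v'.2 = false ∧ v'.1 = ρ
        · have hv' : v' = (ρ, false) := Prod.ext hstop.2 hstop.1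
          subst hv'
          rw [if_pos hstop, stepCost_flatE] at h ⊢
          have h' : walkCost (expo n L) lam (climbs n L k p (s + 1) m) (ρ, false) w ≠ ⊤ := by
            intro htop; rw [htop] at h; exact h rfl
          obtain ⟨hw, hc⟩ := climbs_from_base n L k p lam m (s + 1) ρ w h'
          refine ⟨0, Nat.zero_le _, ?_, ?_⟩
          · rw [hw, climbWalk, climbWalk_zero]
          · rw [hc]
            simp [climbCost]
        · rw [if_neg hstop] at h
          exact absurd rfl h

/-- Conversely, climbing `r ≤ m` times is a finite-cost walk of cost `climbCost`. [folklore] -/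
theorem walkCost_climbWalk (k : ℕ) (hk : 1 ≤ k) (hkL : k ≤ L) (p lam : ℤ) :
    ∀ (m s ρ r : ℕ), r ≤ m →
      walkCost (expo n L) lam (climbs n L k p s m) (ρ, true) (climbWalk ρ m r)
        = (climbCost n L k p s ρ r lam : ℤ)
  | 0, s, ρ, r, hr => by
      have : r = 0 := by omega
      subst this; simp [climbWalk, climbCost]
  | m + 1, s, ρ, 0, _ => by
      rw [climbWalk, climbWalk_zero, climbs_succ, walkCost_cons_cons, climbLayer_true,
        if_neg (by simp), if_pos (by simp), stepCost_flatE, walkCost_replicate_base]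
      simp [climbCost]
  | m + 1, s, ρ, r + 1, hr => by
      rw [climbWalk, climbs_succ, walkCost_cons_cons, climbLayer_true, if_pos (by simp),
        walkCost_climbWalk k hk hkL p lam m (s + 1) (ρ + 1) r (by omega), stepCost,
        expo_cl n L k hk hkL, ← WithTop.coe_add]
      congr 1
      simp only [climbCost]
      push_cast
      ring

/-- The row reached by `climbWalk ρ m r` (`r ≤ m`) is `ρ + r`. [folklore] -/
theorem walkLast_climbWalk_fst : ∀ (ρ m r : ℕ) (b : Bool), r ≤ m →
    (walkLast (ρ, b) (climbWalk ρ m r)).1 = ρ + r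
  | ρ, 0, r, b, hr => by
      have : r = 0 := by omega
      subst this; simp [climbWalk]
  | ρ, m + 1, 0, b, _ => by
      rw [climbWalk, walkLast_cons, climbWalk_zero]
      induction m with
      | zero => simp
      | succ m ih => simpa [List.replicate_succ] using ih
  | ρ, m + 1, r + 1, b, hr => by
      rw [climbWalk, walkLast_cons, walkLast_climbWalk_fst (ρ + 1) m r true (by omega)]
      omega

/-- `climbWalk ρ m r` has length `m`. [folklore] -/
@[simp] theorem length_climbWalk : ∀ (ρ m r : ℕ), (climbWalk ρ m r).length = m
  | _, 0, _ => rfl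
  | ρ, m + 1, 0 => by simp [climbWalk, length_climbWalk ρ m 0]
  | ρ, m + 1, r + 1 => by simp [climbWalk, length_climbWalk (ρ + 1) m r]

/-- `stair(e, r)` has `n + 1` vertices (for `n ≥ 1`). [folklore] -/
theorem length_stairWalk (e r : ℕ) (hn : 1 ≤ n) : (stairWalk n e r).length = n + 1 := by
  simp [stairWalk]; omega

/-- `stair(e, r)` ends at `(e + r, base)`. [folklore] -/
theorem walkLast_stairWalk (v : ℕ × Bool) (e r : ℕ) : walkLast v (stairWalk n e r) = (e + r, false) := by
  simp [stairWalk, walkLast, List.getLastD]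

/-- A walk through the single exit layer is one base vertex in the same row, at cost `0`. [folklore] -/
theorem exit_structure (lam : ℤ) (x : ℕ × Bool) (w : List (ℕ × Bool))
    (h : walkCost (expo n L) lam [exitLayer L] x w ≠ ⊤) :
    w = [(x.1, false)] ∧ walkCost (expo n L) lam [exitLayer L] x w = 0 := by
  match w, h with
  | [], h => simp at h
  | [v'], h =>
      rw [walkCost_cons_cons, walkCost_nil_nil] at h ⊢
      have hx : exitLayer L x v' = if v'.2 = false ∧ v'.1 = x.1 then some (flatE L 0) else none := rfl
      by_cases hv : v'.2 = false ∧ v'.1 = x.1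
      · have : v' = (x.1, false) := Prod.ext hv.2 hv.1
        subst this
        rw [hx, if_pos hv, stepCost_flatE]
        exact ⟨rfl, by simp⟩
      · rw [hx, if_neg hv] at h
        exact absurd rfl h
  | _ :: _ :: _, h => simp at h

/-- From a climbing vertex there is no edge into a staircase: cost `⊤`. [folklore] -/
theorem stair_from_climb (k : ℕ) (p lam : ℤ) (e : ℕ) (w : List (ℕ × Bool)) :
    walkCost (expo n L) lam (stairJ n L k p) (e, true) w = ⊤ := by
  cases w with
  | nil => rfl
  | cons v' w => simp [stairJ, entryLayer, stepCost]

/-- STRUCTURE OF STAIRCASE WALKS.  From `(e, base)`, a finite-cost walk through `J_k(p)`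
(`1 ≤ k ≤ L`) is `stair(e, r)` for a unique `r ≤ n − 1`, and its cost is `stairCost`. [folklore] -/
theorem stair_structure (k : ℕ) (hk : 1 ≤ k) (hkL : k ≤ L) (p lam : ℤ) (e : ℕ) (w : List (ℕ × Bool))
    (h : walkCost (expo n L) lam (stairJ n L k p) (e, false) w ≠ ⊤) :
    ∃ r, r ≤ n - 1 ∧ w = stairWalk n e r ∧
      walkCost (expo n L) lam (stairJ n L k p) (e, false) w = (stairCost n L k p e r lam : ℤ) := by
  match w, h with
  | [], h => simp [stairJ] at h
  | v₁ :: w', h =>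
      rw [stairJ, walkCost_cons_cons] at h ⊢
      have h1 : entryLayer n L k p (e, false) v₁ = if v₁.2 = true ∧ v₁.1 = e then
          some (flatE L (p * e * (2 * hw n L k))) else none := by simp [entryLayer]
      by_cases hv : v₁.2 = true ∧ v₁.1 = e
      swap
      · rw [h1, if_neg hv] at h; exact absurd rfl h
      have : v₁ = (e, true) := Prod.ext hv.2 hv.1
      subst this
      rw [h1, if_pos hv, stepCost_flatE] at h ⊢
      have h' : walkCost (expo n L) lam (climbs n L k p 0 (n - 1) ++ [exitLayer L]) (e, true) w' ≠ ⊤ := by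
        intro htop; rw [htop] at h; exact h rfl
      obtain ⟨hlen, hsplit, hcost⟩ := walkCost_append_split (expo n L) lam _ _ (e, true) w' h'
      rw [length_climbs] at hlen hsplit hcost
      rw [hcost] at h ⊢
      obtain ⟨-, hAB⟩ := WithTop.add_ne_top.1 h
      obtain ⟨hA, hB⟩ := WithTop.add_ne_top.1 hAB
      obtain ⟨r, hr, hw₂, hc₂⟩ := climbs_from_climb n L k hk hkL p lam (n - 1) 0 e _ hA
      obtain ⟨hw₃, hc₃⟩ := exit_structure n L lam _ _ hB
      rw [hw₂, walkLast_climbWalk_fst e (n - 1) r true hr] at hw₃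
      refine ⟨r, hr, ?_, ?_⟩
      · rw [hsplit, hw₂, hw₃]; rfl
      · rw [hc₂, hc₃, add_zero, ← WithTop.coe_add]
        congr 1
        simp only [stairCost, climbCost]
        push_cast
        ring

/-- Conversely, `stair(e, r)` (`r ≤ n − 1`, `1 ≤ k ≤ L`) costs `stairCost`. [folklore] -/
theorem walkCost_stairWalk (k : ℕ) (hk : 1 ≤ k) (hkL : k ≤ L) (p lam : ℤ) (e r : ℕ) (hr : r ≤ n - 1) :
    walkCost (expo n L) lam (stairJ n L k p) (e, false) (stairWalk n e r)
      = (stairCost n L k p e r lam : ℤ) := by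
  rw [stairJ, stairWalk, walkCost_cons_cons,
    walkCost_append (expo n L) lam _ _ (e, true) _ _ (by simp),
    walkCost_climbWalk n L k hk hkL p lam (n - 1) 0 e r hr]
  have h1 : entryLayer n L k p (e, false) (e, true) = some (flatE L (p * e * (2 * hw n L k))) := by
    simp [entryLayer]
  have h3 : walkCost (expo n L) lam [exitLayer L] (walkLast (e, true) (climbWalk e (n - 1) r))
      [(e + r, false)] = 0 := by
    rw [walkCost_cons_cons, walkCost_nil_nil]
    have : exitLayer L (walkLast (e, true) (climbWalk e (n - 1) r)) (e + r, false) = some (flatE L 0) := by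
      simp [exitLayer, walkLast_climbWalk_fst e (n - 1) r true hr]
    rw [this, stepCost_flatE]; rfl
  rw [h1, stepCost_flatE, h3, add_zero, ← WithTop.coe_add]
  congr 1
  simp only [stairCost, climbCost]
  push_cast
  ring

/-- `walkLast` of a concatenated walk. [folklore] -/
theorem walkLast_append {V : Type*} (v : V) : ∀ (w₁ w₂ : List V),
    walkLast v (w₁ ++ w₂) = walkLast (walkLast v w₁) w₂
  | [], _ => rfl
  | a :: w₁, w₂ => by rw [List.cons_append, walkLast_cons, walkLast_cons, walkLast_append a w₁ w₂]

/-- The canonical walk ends at row `i + σ_k(j)`, at the base. [folklore] -/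
theorem walkLast_canon : ∀ (k : ℕ) (p : ℤ) (i j : ℕ),
    walkLast (i, false) (canon n L k p i j) = (i + sig n k j, false)
  | 0, _, _, _ => by simp [canon, sig]
  | k + 1, p, i, j => by
      rw [canon, walkLast_append, walkLast_append, walkLast_canon k, walkLast_stairWalk,
        walkLast_canon k, sig]
      ext <;> simp; ring

/-- Length of the canonical walk. [folklore] -/
theorem length_canon (hn : 1 ≤ n) : ∀ (k : ℕ) (p : ℤ) (i j : ℕ),
    (canon n L k p i j).length = (2 ^ k - 1) * (n + 1)
  | 0, _, _, _ => by simp [canon]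
  | k + 1, p, i, j => by
      rw [canon, List.length_append, List.length_append, length_canon hn k, length_canon hn k,
        length_stairWalk n _ _ hn, pow_succ]
      have : 1 ≤ 2 ^ k := Nat.one_le_two_pow
      zify [this, (by omega : 1 ≤ 2 ^ k * 2)]
      ring

/-- Length of the gadget `𝒢_k(p)`. [folklore] -/
theorem length_gad (hn : 1 ≤ n) : ∀ (k : ℕ) (p : ℤ), (gad n L k p).length = (2 ^ k - 1) * (n + 1)
  | 0, _ => by simp [gad]
  | k + 1, p => by
      rw [gad, List.length_append, List.length_append, length_gad hn k, length_gad hn k,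
        length_stairJ n L _ _ hn, pow_succ]
      have : 1 ≤ 2 ^ k := Nat.one_le_two_pow
      zify [this, (by omega : 1 ≤ 2 ^ k * 2)]
      ring

/-- (H1) The canonical walk has cost `val` (all levels `≤ L`, `n ≥ 1`). [folklore] -/
theorem walkCost_canon (hn : 1 ≤ n) (lam : ℤ) : ∀ (k : ℕ), k ≤ L → ∀ (p : ℤ) (i j : ℕ),
    walkCost (expo n L) lam (gad n L k p) (i, false) (canon n L k p i j) = (val n L k p i j lam : ℤ)
  | 0, _, _, _, _ => by simp [gad, canon, val]
  | k + 1, hk, p, i, j => by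
      rw [gad, canon, val, walkCost_append (expo n L) lam _ _ _ _ _ (by rw [length_canon n L hn, length_gad n L hn]),
        walkCost_append (expo n L) lam _ _ _ _ _ (by rw [length_stairWalk n _ _ hn, length_stairJ n L _ _ hn]),
        walkLast_canon, walkLast_stairWalk, walkCost_canon hn lam k (by omega), walkCost_canon hn lam k (by omega),
        walkCost_stairWalk n L (k + 1) (by omega) hk p lam _ _ (by
          have := Nat.mod_lt j (by omega : 0 < n); omega)]
      push_cast
      ring_nf

/-- COVARIANCE of the value function in the entering row: `val(i) = val(0) + i · p · α`. [folklore] -/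
theorem val_cov (lam : ℤ) : ∀ (k : ℕ) (p : ℤ) (i j : ℕ),
    val n L k p i j lam = val n L k p 0 j lam + i * p * loc n L k j
  | 0, _, _, _ => by simp [val]
  | k + 1, p, i, j => by
      rw [val, val, val_cov lam k (p - slopeP n L (k + 1)) i,
        val_cov lam k (slopeP n L (k + 1)) (i + sig n k (j / n) + j % n),
        val_cov lam k (slopeP n L (k + 1)) (0 + sig n k (j / n) + j % n), loc]
      simp only [stairCost]
      push_cast
      ring

end

/-- Registered stub of this file: (H1) the canonical walk of `𝒢_k(p)` costs `val`. [folklore] -/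
theorem stub_stairGadget : ∀ (n L : ℕ), 1 ≤ n → ∀ (lam : ℤ) (k : ℕ), k ≤ L → ∀ (p : ℤ) (i j : ℕ), walkCost (expo n L) lam (gad n L k p) (i, false) (canon n L k p i j) = (val n L k p i j lam : WithTop ℤ) :=
  fun n L hn lam k hk p i j => walkCost_canon n L hn lam k hk p i j


end Summit.ValiantsHypothesis.ValiantsHypothesis.Theorems.SymmetroidDescartes.DPR
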